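import Summits.BirchSwinnertonDyer.Rank1Residual.ManinAdditive.EvenKummerShimuraNodes
import HarnessLib

/-!
# S-an-g42-1 `EtaQuotientInvariantOfHalfNewman` holds: `η`-quotients with HALVED Newman
# congruences are `Γ(8N)`-invariant (C2 line `ManinOddAtFour`, stmt-BirchSwinnertonDyer-22967;
# cell bsd-f2-manin, prover seat p2 g20; TURNKEY P-an-g42-1 (α) of E-an-237)

Let `η_s(τ) = ∏_{δ ∣ N} η(δτ)^{s_δ}` with `Σ s_δ = 0`, `12 ∣ S₁ := Σ δ s_δ` and `12 ∣ S₂ := Σ (N/δ) s_δ`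
(the halves of Newman's congruences — automatic for `s = r/2` when `r` is an all-even Newman vector —
but WITHOUT Newman's square condition on `∏ δ^{|s_δ|}`).  We prove that `η_s(γτ) = η_s(τ)` for every
`γ ∈ Γ(8N)`:

* `etaQuotientInvariantOfHalfNewman_holds : KummerShimuraTwo.EtaQuotientInvariantOfHalfNewman`
  (the node of `Rank1Residual/ManinAdditive/EvenKummerShimuraNodes`, BY NAME), from
* `etaQuotient_smul_of_mem_Gamma_eight_mul` (all `γ ∈ Γ(8N)`), from the core case
* `etaQuotient_SL2_smul_of_halfNewman` (`c > 0`, `8N ∣ c`, `8 ∣ b`, `8N ∣ d - 1`).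

PROOF (a re-run of the tree's Newman criterion `etaQuotient_SL2_smul_of_odd` with `k = 0`).  By the
transformation law of `η` (`eta_SL2_smul`, second Petersson–Knopp form `etaMultiplier_of_odd_d`)
applied to the conjugates `γ_δ = (a, bδ; c/δ, d)`, `η_s(γτ) = [∏_δ v_η(γ_δ)^{s_δ}]·(√(cτ+d))^{Σ s_δ}·η_s(τ)`;
the automorphy factor is `1` as `Σ s_δ = 0`; the exponential part of the bracket is
`ζ₂₄^{[(a−2d)c′ − bdc′²N]·S₂ + bd·S₁ + (3d−3)·Σ s_δ}` (`c′ = c/N`; `halfNewman_exponent_sum_dvd`), which is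
`1` because `8 ∣ c′`, `8 ∣ b`, `12 ∣ S₁, S₂` and `Σ s_δ = 0` — no parity of `d` and no `24`-congruence is
needed; the Jacobi part is `∏_δ (c_δ/|d|)^{s_δ} = (c/|d|)^{Σ s_δ} · ∏ (δ/|d|)^{s_δ}` with `(δ/|d|) = 1` for every
`δ ∣ N` when `d ≡ 1 (mod 8N)` (`jacobiSym_natAbs_eq_one_of_dvd_sub_one`: write `δ = 2^α δ₁`, then
`(δ/|d|) = χ₈(d)^α ε(δ₁,d) (d/δ₁)` by the tree's `jacobiSym_two_pow_mul`, and `χ₈(d) = 1`, `ε = 1`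
(`d ≡ 1 mod 4`), `(d/δ₁) = (1/δ₁) = 1`).  The case `c < 0` is `γ⁻¹` (lower-left entry `−c > 0`, lower-right
entry `a ≡ 1`) applied at `γτ`; the case `c = 0` is `γ = T^b` with `8 ∣ b`, where
`η_s(τ + b) = e^{2πi b S₁/24} η_s(τ) = η_s(τ)` as `96 ∣ b S₁` (`etaQuotientC_add_intCast`).

This is the character form of Newman's theorem (Gordon–Hughes–Newman: `η_s ∣ γ = ψ(γ) η_s` on `Γ₀(N)`
with `ψ` built from `ζ₂₄` and `(∏ δ^{|s_δ|}/|d|)`) restricted to `Γ(8N)`, where `ψ` dies.  It is stub (α)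
of E-an-237 `EvenKummerRepCongruencePeriodic` (MEMO-an §87); (β)/(γ) are not touched here.
HONEST FRAMING: E-an-237, C2 `ManinOddAtFour`, C3 and Manin's conjecture remain OPEN; BSD is not proved
by this.  [cite: Newman1959] [cite: Savitt2025, Thm. 1] [cite: Knopp1970, Ch. 4, Thm. 2] [folklore]
-/

set_option autoImplicit false

set_option linter.dupNamespace false

noncomputable section

open UpperHalfPlane hiding I
open ModularForm Complex Matrix.SpecialLinearGroup CongruenceSubgroup
open scoped MatrixGroups Real ModularForm CongruenceSubgroup NumberTheorySymbols
open Literature.NumberTheory.EllipticCurves.ModularForms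

namespace Summit.BirchSwinnertonDyer.BirchSwinnertonDyer.Theorems.ManinLocalTwoThree.EtaHalfNewman

/-! ## Translations -/

/-- `∏ η(δ(z+n))^{r_δ} = e^{2πi · n Σ δ r_δ/24} · ∏ η(δz)^{r_δ}` for `n ∈ ℤ`. [folklore] -/
theorem etaQuotientC_add_intCast (N : ℕ) (r : ℕ → ℤ) (z : ℂ) (n : ℤ) :
    etaQuotientC N r (z + n) =
      cexp (2 * π * I * (n * ∑ δ ∈ N.divisors, (δ : ℤ) * r δ : ℤ) / 24) * etaQuotientC N r z := by
  unfold etaQuotientC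
  have hδ : ∀ δ : ℕ, η (δ * (z + n)) = cexp (2 * π * I * ((δ : ℤ) * n : ℤ) / 24) * η (δ * z) :=
    fun δ ↦ by
    rw [mul_add, show (δ : ℂ) * (n : ℂ) = (((δ : ℤ) * n : ℤ) : ℂ) by push_cast; ring, eta_add_intCast]
  simp_rw [hδ, mul_zpow, Finset.prod_mul_distrib]
  congr 1
  rw [show (2 * π * I * ((n * ∑ δ ∈ N.divisors, (δ : ℤ) * r δ : ℤ) : ℂ) / 24 : ℂ) =
      ∑ δ ∈ N.divisors, (r δ : ℂ) * (2 * π * I * (((δ : ℤ) * n : ℤ) : ℂ) / 24) by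
    push_cast
    rw [Finset.mul_sum, Finset.mul_sum, Finset.sum_div]
    exact Finset.sum_congr rfl fun δ _ ↦ by ring, Complex.exp_sum]
  refine Finset.prod_congr rfl fun δ _ ↦ ?_
  rw [← Complex.exp_int_mul]

/-- Translation invariance `η_r(z + n) = η_r(z)` as soon as `24 ∣ n · Σ δ r_δ` (e.g. `8 ∣ n` and
`12 ∣ Σ δ r_δ`). [folklore] -/
theorem etaQuotientC_add_intCast_of_dvd_mul (N : ℕ) (r : ℕ → ℤ) (z : ℂ) (n : ℤ)
    (h : (24 : ℤ) ∣ n * ∑ δ ∈ N.divisors, (δ : ℤ) * r δ) :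
    etaQuotientC N r (z + n) = etaQuotientC N r z := by
  obtain ⟨t, ht⟩ := h
  rw [etaQuotientC_add_intCast, ht, show (2 * π * I * ((24 * t : ℤ) : ℂ) / 24 : ℂ) = t * (2 * π * I) by
    push_cast; ring, Complex.exp_int_mul_two_pi_mul_I, one_mul]

/-! ## The exponential part of the multiplier -/

/-- **Halved Newman exponent congruence**: with `Σ s_δ = 0`, `12 ∣ S₁ = Σ δ s_δ`, `12 ∣ S₂ = Σ (N/δ) s_δ`,
`8 ∣ b` and `8 ∣ c'`, `Σ_δ s_δ P₂(a, bδ, c'(N/δ), d) ≡ 0 (mod 24)`; indeed the sum equals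
`[(a − 2d)c' − bd c'² N]·S₂ + bd·S₁ + (3d − 3)·Σ s_δ`.  No hypothesis on `d`. [folklore] -/
theorem halfNewman_exponent_sum_dvd (N : ℕ) (s : ℕ → ℤ)
    (h0 : ∑ δ ∈ N.divisors, s δ = 0) (h1 : (12 : ℤ) ∣ ∑ δ ∈ N.divisors, (δ : ℤ) * s δ)
    (h2 : (12 : ℤ) ∣ ∑ δ ∈ N.divisors, ((N / δ : ℕ) : ℤ) * s δ) (a b c' d : ℤ)
    (hb : (8 : ℤ) ∣ b) (hc' : (8 : ℤ) ∣ c') :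
    (24 : ℤ) ∣ ∑ δ ∈ N.divisors, s δ * etaP₂ a (b * δ) (c' * (N / δ : ℕ)) d := by
  have hpt : ∀ δ ∈ N.divisors, s δ * etaP₂ a (b * δ) (c' * (N / δ : ℕ)) d =
      ((a - 2 * d) * c' - b * d * c' ^ 2 * N) * (((N / δ : ℕ) : ℤ) * s δ) + b * d * ((δ : ℤ) * s δ)
        + (3 * d - 3) * s δ := fun δ hδ ↦ by
    have hNδ : (δ : ℤ) * ((N / δ : ℕ) : ℤ) = N := by
      exact_mod_cast Nat.mul_div_cancel' (Nat.dvd_of_mem_divisors hδ)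
    unfold etaP₂
    linear_combination (-(b * d * c' ^ 2 * ((N / δ : ℕ) : ℤ) * s δ)) * hNδ
  rw [Finset.sum_congr rfl hpt, Finset.sum_add_distrib, Finset.sum_add_distrib, ← Finset.mul_sum,
    ← Finset.mul_sum, ← Finset.mul_sum, h0, mul_zero, add_zero]
  have h96 : (24 : ℤ) ∣ 8 * 12 := by norm_num
  refine dvd_add (h96.trans (mul_dvd_mul ?_ h2)) (h96.trans (mul_dvd_mul (hb.mul_right d) h1))
  rw [show (a - 2 * d) * c' - b * d * c' ^ 2 * N = c' * ((a - 2 * d) - b * d * c' * N) by ring]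
  exact hc'.mul_right _

/-! ## The Jacobi part of the multiplier -/

/-- For `δ ∣ N` (`N ≥ 1`) and `d ≡ 1 (mod 8N)`, `(δ / |d|) = 1`: writing `δ = 2^α δ₁` with `δ₁` odd,
`(δ/|d|) = χ₈(d)^α · ε(δ₁, d) · (d/δ₁)` (`jacobiSym_two_pow_mul`) and `χ₈(d) = χ₈(1) = 1`,
`ε(δ₁, d) = 1` (`d ≡ 1 mod 4`), `(d/δ₁) = (1/δ₁) = 1` (`d ≡ 1 mod δ₁`). [folklore] -/
theorem jacobiSym_natAbs_eq_one_of_dvd_sub_one {N δ : ℕ} (hδ : δ ∈ N.divisors) {d : ℤ}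
    (hd : (8 * N : ℤ) ∣ d - 1) : J((δ : ℤ) | d.natAbs) = 1 := by
  obtain ⟨α, δ₁, hδ₁, rfl⟩ := Nat.exists_eq_two_pow_mul_odd (Nat.pos_of_mem_divisors hδ).ne'
  have h8 : (8 : ℤ) ∣ d - 1 := (dvd_mul_right (8 : ℤ) N).trans hd
  have hδ₁d : (δ₁ : ℤ) ∣ d - 1 := by
    refine dvd_trans ?_ hd
    have h1 : δ₁ ∣ N := (Dvd.intro_left _ rfl : δ₁ ∣ 2 ^ α * δ₁).trans (Nat.dvd_of_mem_divisors hδ)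
    exact (Int.natCast_dvd_natCast.mpr h1).trans (dvd_mul_left (N : ℤ) 8)
  have hdodd : Odd d := Int.odd_iff.mpr (by omega)
  rw [jacobiSym_two_pow_mul hδ₁ hdodd]
  have hz : (d : ZMod 8) = 1 := by
    have := (ZMod.intCast_zmod_eq_zero_iff_dvd (d - 1) 8).mpr h8
    push_cast at this
    exact sub_eq_zero.mp this
  have hrec : recipSign (δ₁ : ℤ) d = 1 := by
    unfold recipSign
    rw [if_neg (by omega)]
  have hJ : J(d | δ₁) = 1 := by
    rw [jacobiSym.mod_left' (Int.modEq_iff_dvd.mpr hδ₁d).symm, jacobiSym.one_left]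
  rw [hz, MulChar.map_one, one_pow, hrec, hJ]
  norm_num

/-- `∏_δ u^{s_δ} = u^{Σ s_δ}` for `u ≠ 0`. [folklore] -/
theorem prod_zpow_eq_zpow_sum {u : ℂ} (hu : u ≠ 0) (t : Finset ℕ) (s : ℕ → ℤ) :
    ∏ δ ∈ t, u ^ (s δ) = u ^ (∑ δ ∈ t, s δ) := by
  induction t using Finset.induction_on with
  | empty => simp
  | insert a t ha ih => rw [Finset.prod_insert ha, Finset.sum_insert ha, ih, zpow_add₀ hu]

/-- **The Jacobi symbols multiply to `1`**: for `gcd(c, d) = 1`, `c = δ c_δ` and `(δ/|d|) = 1` for all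
`δ ∣ N`, and `Σ s_δ = 0`, `∏_δ (c_δ/|d|)^{s_δ} = (c/|d|)^{Σ s_δ} = 1`. [folklore] -/
theorem halfNewman_jacobi_prod_eq_one (N : ℕ) (s : ℕ → ℤ) (h0 : ∑ δ ∈ N.divisors, s δ = 0)
    (c d : ℤ) (hcop : IsCoprime c d) (hJ : ∀ δ ∈ N.divisors, J((δ : ℤ) | d.natAbs) = 1)
    (cδ : ℕ → ℤ) (hcδ : ∀ δ ∈ N.divisors, c = δ * cδ δ) :
    ∏ δ ∈ N.divisors, ((J(cδ δ | d.natAbs) : ℤ) : ℂ) ^ (s δ) = 1 := by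
  have hfac : ∀ δ ∈ N.divisors, J(cδ δ | d.natAbs) = J(c | d.natAbs) := fun δ hδ ↦ by
    rw [hcδ δ hδ, jacobiSym.mul_left, hJ δ hδ, one_mul]
  rw [Finset.prod_congr rfl fun δ hδ ↦ by rw [hfac δ hδ]]
  have hcg : c.gcd d.natAbs = 1 := by
    have : Int.gcd c d = 1 := Int.isCoprime_iff_gcd_eq_one.mp hcop
    simpa [Int.gcd, Int.natAbs_abs] using this
  have hu : ((J(c | d.natAbs) : ℤ) : ℂ) ≠ 0 := by
    rcases jacobiSym.eq_one_or_neg_one hcg with h | h <;> rw [h] <;> norm_num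
  rw [prod_zpow_eq_zpow_sum hu, h0, zpow_zero]

/-! ## The core case `c > 0` -/

/-- **Core case.**  For `N ≥ 1`, an exponent vector `s` with `Σ s_δ = 0`, `12 ∣ Σ δ s_δ`,
`12 ∣ Σ (N/δ) s_δ`, and `γ = (a b; c d) ∈ SL₂(ℤ)` with `8N ∣ c`, `c > 0`, `8 ∣ b`, `d ≡ 1 (mod 8N)`:
`η_s(γτ) = η_s(τ)`.  Proof = `etaQuotient_SL2_smul_of_odd` with `k = 0`, the two Newman inputs
replaced by `halfNewman_exponent_sum_dvd` and `halfNewman_jacobi_prod_eq_one`.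
[cite: Savitt2025, Thm. 1] [cite: Knopp1970, Ch. 4, Thm. 2] -/
theorem etaQuotient_SL2_smul_of_halfNewman (N : ℕ) (hN : 0 < N) (s : ℕ → ℤ)
    (h0 : ∑ δ ∈ N.divisors, s δ = 0)
    (h1 : (12 : ℤ) ∣ ∑ δ ∈ N.divisors, (δ : ℤ) * s δ)
    (h2 : (12 : ℤ) ∣ ∑ δ ∈ N.divisors, ((N / δ : ℕ) : ℤ) * s δ)
    (γ : SL(2, ℤ)) (hγc : (8 * N : ℤ) ∣ γ 1 0) (hc : 0 < γ 1 0) (hγb : (8 : ℤ) ∣ γ 0 1)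
    (hγd : (8 * N : ℤ) ∣ γ 1 1 - 1) (τ : ℍ) :
    etaQuotient N s (γ • τ) = etaQuotient N s τ := by
  obtain ⟨c'', hc''⟩ := hγc
  set cN : ℤ := 8 * c'' with hcNdef
  have hcN : γ 1 0 = N * cN := by rw [hc'']; ring
  have hcNpos : 0 < cN := by
    rcases lt_trichotomy cN 0 with h | h | h
    · nlinarith [hcN]
    · rw [h, mul_zero] at hcN; omega
    · exact h
  -- the conjugates `γ_δ`, `c/δ = cN (N/δ)`
  have hcδ : ∀ δ ∈ N.divisors, γ 1 0 = δ * (cN * (N / δ : ℕ)) := fun δ hδ ↦ by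
    have hNδ : ((δ : ℕ) : ℤ) * ((N / δ : ℕ) : ℤ) = N := by
      exact_mod_cast Nat.mul_div_cancel' (Nat.dvd_of_mem_divisors hδ)
    rw [hcN, ← hNδ]; ring
  have hcδpos : ∀ δ ∈ N.divisors, 0 < cN * (N / δ : ℕ) := fun δ hδ ↦
    mul_pos hcNpos (by exact_mod_cast Nat.div_pos (Nat.divisor_le hδ) (Nat.pos_of_mem_divisors hδ))
  set j : ℂ := (γ 1 0 : ℂ) * τ + γ 1 1 with hj
  have hjne : j ≠ 0 := SL2_denom_ne_zero γ τ
  -- each factor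
  have hfactor : ∀ δ ∈ N.divisors, η (δ * ((γ • τ : ℍ) : ℂ)) =
      etaMultiplier (γ 0 0) (γ 0 1 * δ) (cN * (N / δ : ℕ)) (γ 1 1) * Complex.sqrt j *
        η (δ * (τ : ℂ)) := fun δ hδ ↦ by
    have hδ0 := Nat.pos_of_mem_divisors hδ
    obtain ⟨h00, h01, h10, h11⟩ := conjDelta_apply γ δ _ (hcδ δ hδ)
    have := eta_SL2_smul (conjDelta γ δ _ (hcδ δ hδ)) (Or.inl (by rw [h10]; exact hcδpos δ hδ))
      (natMulPt δ hδ0 τ)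
    rw [natMul_coe_SL2_smul γ δ hδ0 _ (hcδ δ hδ), this, etaMultiplierSL, h00, h01, h10, h11,
      coe_natMulPt]
    congr 2
    rw [hj]
    have : ((γ 1 0 : ℤ) : ℂ) = δ * (cN * (N / δ : ℕ) : ℤ) := by exact_mod_cast hcδ δ hδ
    rw [this]; push_cast; ring
  rw [etaQuotient_apply, etaQuotient_apply, Finset.prod_congr rfl fun δ hδ ↦ by rw [hfactor δ hδ]]
  simp_rw [mul_zpow, Finset.prod_mul_distrib]
  -- the automorphy factors: `∏ (√j)^{s_δ} = (√j)^{0} = 1`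
  have hsqrt : ∏ δ ∈ N.divisors, Complex.sqrt j ^ (s δ) = 1 := by
    have hsne : Complex.sqrt j ≠ 0 := fun h ↦ hjne (by rw [← csqrt_sq j, h]; simp)
    rw [prod_zpow_eq_zpow_sum hsne, h0, zpow_zero]
  -- `d` is odd (`d ≡ 1 mod 8`)
  have hd : Odd (γ 1 1) := by
    have h8 : (8 : ℤ) ∣ γ 1 1 - 1 := (dvd_mul_right (8 : ℤ) N).trans hγd
    exact Int.odd_iff.mpr (by omega)
  -- the multipliers: Jacobi part and exponential part
  have hmult : ∏ δ ∈ N.divisors,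
      etaMultiplier (γ 0 0) (γ 0 1 * δ) (cN * (N / δ : ℕ)) (γ 1 1) ^ (s δ) = 1 := by
    rw [Finset.prod_congr rfl fun δ hδ ↦ by
      rw [etaMultiplier_of_odd_d (hcδpos δ hδ) hd, mul_zpow, ← Complex.exp_int_mul]]
    rw [Finset.prod_mul_distrib, ← Complex.exp_sum]
    have hcop : IsCoprime (γ 1 0) (γ 1 1) := by
      refine ⟨γ 1 1 * 0 + -γ 0 1, γ 0 0, ?_⟩
      linear_combination det_entries γ
    rw [halfNewman_jacobi_prod_eq_one N s h0 (γ 1 0) (γ 1 1) hcop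
      (fun δ hδ ↦ jacobiSym_natAbs_eq_one_of_dvd_sub_one hδ hγd) (fun δ ↦ cN * (N / δ : ℕ)) hcδ,
      one_mul]
    obtain ⟨t, ht⟩ := halfNewman_exponent_sum_dvd N s h0 h1 h2 (γ 0 0) (γ 0 1) cN (γ 1 1) hγb
      ⟨c'', hcNdef⟩
    rw [show (∑ δ ∈ N.divisors, (s δ : ℂ) * (π * I / 12 *
        (etaP₂ (γ 0 0) (γ 0 1 * δ) (cN * (N / δ : ℕ)) (γ 1 1) : ℤ))) = (t : ℂ) * (2 * π * I) by
      rw [show (t : ℂ) * (2 * π * I) = π * I / 12 * ((24 * t : ℤ) : ℂ) by push_cast; ring, ← ht,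
        Int.cast_sum, Finset.mul_sum]
      exact Finset.sum_congr rfl fun δ _ ↦ by push_cast; ring]
    exact Complex.exp_int_mul_two_pi_mul_I t
  rw [hmult, hsqrt, one_mul, one_mul]

/-! ## All of `Γ(8N)` -/

/-- The entries of `γ ∈ Γ(8N)`: `8N ∣ c`, `8 ∣ b`, `8N ∣ d − 1`. [folklore] -/
theorem entries_of_mem_Gamma_eight_mul {N : ℕ} {g : SL(2, ℤ)} (hg : g ∈ CongruenceSubgroup.Gamma (8 * N)) :
    (8 * N : ℤ) ∣ g 1 0 ∧ (8 : ℤ) ∣ g 0 1 ∧ (8 * N : ℤ) ∣ g 1 1 - 1 := by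
  rw [Gamma_mem] at hg
  obtain ⟨-, hb, hc, hd⟩ := hg
  have hN8 : (((8 * N : ℕ) : ℤ)) = 8 * N := by push_cast; ring
  refine ⟨?_, ?_, ?_⟩
  · rw [← hN8]; exact (ZMod.intCast_zmod_eq_zero_iff_dvd _ _).mp hc
  · refine (dvd_mul_right (8 : ℤ) N).trans ?_
    rw [← hN8]; exact (ZMod.intCast_zmod_eq_zero_iff_dvd _ _).mp hb
  · rw [← hN8]
    refine (ZMod.intCast_zmod_eq_zero_iff_dvd _ _).mp ?_
    push_cast
    rw [hd, sub_self]

/-- **`η`-quotients with halved Newman congruences are `Γ(8N)`-invariant**: for `N ≥ 1` and `s` with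
`Σ s_δ = 0`, `12 ∣ Σ δ s_δ`, `12 ∣ Σ (N/δ) s_δ`, `η_s(γτ) = η_s(τ)` for every `γ ∈ Γ(8N)` and `τ ∈ ℍ`.
The cases `c < 0` and `c = 0` reduce to the core case via `γ⁻¹` (whose lower-right entry is `a ≡ 1`)
and to the translation `τ ↦ τ + b`, `8 ∣ b` (`96 ∣ b·S₁`). [cite: Newman1959] [cite: Savitt2025, Thm. 1] -/
theorem etaQuotient_smul_of_mem_Gamma_eight_mul (N : ℕ) (hN : 0 < N) (s : ℕ → ℤ)
    (h0 : ∑ δ ∈ N.divisors, s δ = 0)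
    (h1 : (12 : ℤ) ∣ ∑ δ ∈ N.divisors, (δ : ℤ) * s δ)
    (h2 : (12 : ℤ) ∣ ∑ δ ∈ N.divisors, ((N / δ : ℕ) : ℤ) * s δ)
    {γ : SL(2, ℤ)} (hγ : γ ∈ CongruenceSubgroup.Gamma (8 * N)) (τ : ℍ) :
    etaQuotient N s (γ • τ) = etaQuotient N s τ := by
  rcases lt_trichotomy (γ 1 0) 0 with hneg | hzero | hpos
  · -- `c < 0`: apply the core case to `γ⁻¹` at the point `γ • τ`
    obtain ⟨hc, hb, hd⟩ := entries_of_mem_Gamma_eight_mul (inv_mem hγ)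
    have h10 : (γ⁻¹ : SL(2, ℤ)) 1 0 = -γ 1 0 := by
      simp [Matrix.SpecialLinearGroup.coe_inv, Matrix.adjugate_fin_two]
    have key := etaQuotient_SL2_smul_of_halfNewman N hN s h0 h1 h2 γ⁻¹ hc (by rw [h10]; linarith)
      hb hd (γ • τ)
    rw [inv_smul_smul] at key
    exact key.symm
  · -- `c = 0`: `γ = T^b` with `8 ∣ b`
    obtain ⟨-, hb, hd⟩ := entries_of_mem_Gamma_eight_mul hγ
    have hdet := det_entries γ
    have hd1 : γ 1 1 = 1 := by
      rcases SL2Z_d_of_c_eq_zero γ hzero with h | h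
      · exact h
      · exfalso
        rw [h] at hd
        obtain ⟨t, ht⟩ := hd
        have h8 : (8 : ℤ) ∣ -1 - 1 := ⟨N * t, by rw [ht]; ring⟩
        omega
    have ha : γ 0 0 = 1 := by rw [hzero, hd1] at hdet; linarith
    have hcoe : ((γ • τ : ℍ) : ℂ) = (τ : ℂ) + (γ 0 1 : ℤ) := by
      rw [coe_SL2_smul, ha, hzero, hd1]; push_cast; ring
    rw [etaQuotient, etaQuotient, hcoe]
    exact etaQuotientC_add_intCast_of_dvd_mul N s τ (γ 0 1)
      ((show (24 : ℤ) ∣ 8 * 12 by norm_num).trans (mul_dvd_mul hb h1))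
  · obtain ⟨hc, hb, hd⟩ := entries_of_mem_Gamma_eight_mul hγ
    exact etaQuotient_SL2_smul_of_halfNewman N hN s h0 h1 h2 γ hc hpos hb hd τ

/-! ## The node, by name -/

/-- **S-an-g42-1 `EtaQuotientInvariantOfHalfNewman` HOLDS** (TURNKEY P-an-g42-1 (α), MEMO-an §87): an
`η`-quotient whose exponent vector satisfies the three halved Newman congruences `Σ s_δ = 0`,
`12 ∣ Σ δ s_δ`, `12 ∣ Σ (N/δ) s_δ` is invariant under `Γ(8N)`.  Stub (α) of E-an-237
`EvenKummerRepCongruencePeriodic`; (β)/(γ) and E-an-237 itself remain open here; C2 `ManinOddAtFour`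
is OPEN; BSD is not proved by this. [cite: Newman1959] [cite: Savitt2025, Thm. 1] -/
theorem etaQuotientInvariantOfHalfNewman_holds :
    Summit.BirchSwinnertonDyer.Rank1Residual.ManinAdditive.KummerShimuraTwo.EtaQuotientInvariantOfHalfNewman := by
  intro N hN s h0 h1 h2 γ hγ τ
  exact etaQuotient_smul_of_mem_Gamma_eight_mul N hN s h0 h1 h2 hγ τ

end Summit.BirchSwinnertonDyer.BirchSwinnertonDyer.Theorems.ManinLocalTwoThree.EtaHalfNewman

end
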